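import Summits.QuantumFields.YangMills.Theorems.BalabanUVNodesN11TStepOldBranchInnerSumOfProvisos
import Summits.QuantumFields.YangMills.Theorems.BalabanUVNodesN11Sect3SupplyChainTermRows

/-!
# DAG node N11 — THE OPERAND ROWS AT ANY HISTORY FROM dag-n11-w3's TERM ROWS; the term rows of `graftAboveB`; the old-branch (O3′) theorem `_of_provisos` with its two operand rows
# read from term rows (`TermRowsAt`)

HEADER — WORK-UNIT METADATA.  Cell `pub-ymgap`, YM-PLAN Track A (HUMAN RULING D-0062 ∕ D-0149), width seat `pub-ymgap-dag-n11-w2` (g4; WIDTH SEAT 2∕4 on N11 [B14]),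
route `BalabanUVNodes`; this seat's jail key is K1⁷ `stmt-QuantumFields-20542` (`--kind proof --supports 20542 --as helper`, count-neutral); the K1 face of record since
KEY MAP v2 is K1⁹ `StabilityBRunRowsAtRecordR13SepCoPHV` = stmt-QuantumFields-27364 (MIS-KEY ∕ VALID rule R463 (4)(a): lineage BY NAME).  [III] = [Balaban1988Convergent].
Sequel of this seat's `…TStepOldBranchInnerSumOfProvisos` (§2: the (O3′) disjunction on the old-branch road from `θ.Provisos₁₃CoPH`, `hform`, four residual-measurability rows, two
OPERAND rows `hΦ₀m` ∕ `hΦm`, and the chart-side data), over dag-n11-w3 g2's `…Sect3SupplyChainTermRows` (`TermRowsAt`, `termRowsAt_of_eq`, `termRowsAt_zero`, `exists_uniform_bound`,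
and the PATTERN of `operandRowsAt_of_termRows`), dag-n11-d's `…OperandRowsOfTermRows` (`measurable_sect2Operand_of_termRows`, `exists_bound_sect2Operand_of_termBounds`) ∕
`…BackgroundCoPMeasurable` (`measurable_UbgOfRecord₁₃CoP`), dag-n08-w2's `sect2Operand_congr_of_agree_pos`, dag-n11-e's `…Sect3SupplySpliceDefs` ∕ `…SpliceOwnBoundary` (`graftAbove`,
`graftAboveB` and their selectors).  Bus: CLAIM-4 of g4.

WHY THIS FILE.  The two operand rows left displayed by `…OldBranchInnerSumOfProvisos` §2 — measurability, on the multiscale configuration space, of the OLD operand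
`e^{A_k(init s′; t(init s′), E_k, U_k)}` and of the NEW operand `e^{A_{k+1}(s′; t′, E′, U_{k+1})}` — are read most naturally from dag-n11-w3's TERM ROWS `TermRowsAt θ p t₀ j` (their
`SupplierTermRows` inhabits them along the chain; `termRowsAt_spliceTermsB` passes them through the splice).  dag-n11-w3's `operandRowsAt_of_termRows` produces `OperandRowsAt θ p k s t₀ E₀`
— the operand at `init s` for a history `s` of length `k+1` — whereas the NEW operand sits at `s′` ITSELF (background map `UbgOfRecord₁₃CoP … (k+1) s′`).  §1 re-runs their proof AT ANY
HISTORY `s₀` of any length (the truncation of `t₀` to the levels `1 … k`, (2.23)'s level range via `sect2Operand_congr_of_agree_pos`, one bound per row family); §2 records the term rows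
of `graftAboveB k t u` (the witness of `PresentChildObligations`' (O3′) clause) from those of `t` and `u`, level by level (the present case of dag-n11-w3's `termRowsAt_spliceTermsB`, for
the bare graft); §3 is `…OldBranchInnerSumOfProvisos` §2 with `hΦ₀m` ∕ `hΦm` READ FROM TERM ROWS.

WHAT THIS FILE PROVES (0 `sorry`, 0 `def`, standard axioms).
§1 ★★ `operandRows_at_history_of_termRows` (at ANY history `s₀` of length `k`: the operand of `(t₀, E₀)` at `s₀` with background `UbgOfRecord₁₃CoP … k s₀` is measurable on the multiscale
configuration space for EVERY branch `S`, and bounded above, from `TermRowsAt θ p t₀ j`, `1 ≤ j ≤ k`).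
§2 ★ `termRowsAt_graftAboveB` (level `j` of `graftAboveB k t u` has the rows if `t` has them at `j` (when `j ≤ k`) and `u` has them at `j` (when `k ≤ j`)).
§3 ★★★★★★ `slotsTOfRecord₁₃H_succ_O3_of_hasSect2FormAtZS_of_oldBranchInnerSum_of_provisos_of_termRows` (the (O3′) DISJUNCTION on the old-branch road from `θ.Provisos₁₃CoPH`, `hform`, the
four residual-measurability rows, `TermRowsAt θ p (t s′.init) j` for `1 ≤ j ≤ k`, `TermRowsAt θ p t′ j` for `1 ≤ j ≤ k+1`, and the chart-side data `Fᵢ₀` ∕ `hFm₀` ∕ `hin₀` ∕ `hinner₀`).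

HONEST FRAMING.  Helper lane, count-neutral; KERNEL BOOKKEEPING (measurability ∕ bounds transfer through pointwise selections; one level-range identity) BY NAME; `TermRowsAt` is a
DISPLAYED hypothesis on term values (def-T's `Sect2.TermValues` carries no such law); every chart-side hypothesis and the level-`k` form DISPLAYED — `hinner₀` is where [I] §2 ∕ [III] §3 ∕
Thm 2 live, NOT proved here; NO chart of Bałaban's, NO Jacobian, NO Gaussian integration asserted; (B4) ∕ (S-α) ∕ (O3′) NOT closed; N11 NOT discharged; K1⁹ NOT closed, no registered
stub touched; counts unmoved (typed 28∕28 · discharged 5∕27 · A 5∕28).  One finite `𝕋⁴_{L^K}` programme at fixed `ε = L^{−K}`; R4 closes only the conditional finite-𝕋⁴ rung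
`BalabanLadder.UV` — NOT ℝ⁴, NOT OS, NOT a mass gap, NOT Clay.  No `sorry`, `axiom`, `def`, `instance`, `notation`.  Sources (SHAPE ∕ bookkeeping only): [III] (2.18) p.257,
(2.20)–(2.27) pp.258–259, (2.30)–(2.31) p.260, (2.40)–(2.41) p.261, (3.16)–(3.21) pp.268–269, (3.24)–(3.25) p.270, §3 p.279, Thm 1 p.262, Thm 2 p.263.
-/

noncomputable section

open MeasureTheory ProbabilityTheory
open scoped ENNReal NNReal BigOperators Matrix.Norms.L2Operator

namespace Summit.QuantumFields.YangMills.Theorems.BalabanUVNodesN11OperandRowAtHistoryOfTermRows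

open Literature.MathematicalPhysics.QuantumFieldTheory.Balaban1983to89
open Literature.MathematicalPhysics.QuantumFieldTheory.Balaban1983to89.T4AveragingDisintegration
open T4Continuum T4NestedCovariance Node00.Tk B15DeterminingSets B14.Eq225Concrete
open Node00 hiding SU
open B10Eq42TorusConstraint (bondsIn)
open BalabanUVNodesN11Sect3SupplySpliceDefs
open BalabanUVNodesN11Sect3SupplySpliceOwnBoundary (graftAboveB graftAboveB_E_of_le graftAboveB_R_of_le graftAboveB_B_of_lt graftAboveB_B_of_le graftAboveB_E_of_lt
  graftAboveB_R_of_lt)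
open BalabanUVNodesN11Sect3SupplyChainTermRows (TermRowsAt termRowsAt_of_eq termRowsAt_zero exists_uniform_bound)
open BalabanUVNodesN11FirstStepSupply (sect2Operand_congr_of_agree_pos)
open BalabanUVNodesN11OperandRowsOfTermRows (measurable_sect2Operand_of_termRows exists_bound_sect2Operand_of_termBounds)
open BalabanUVNodesN11BackgroundCoPMeasurable (measurable_UbgOfRecord₁₃CoP)
open BalabanUVNodesN11TStepOldBranchInnerSumOfProvisos (slotsTOfRecord₁₃H_succ_O3_of_hasSect2FormAtZS_of_oldBranchInnerSum_of_provisos)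

variable {F : T4Family} {N : ℕ} [NeZero N]

/-! ## §1  The operand rows at ANY history from the term rows at the levels `1 … k` -/

section AtHistory

variable (θ : Stage13HParams F N) (p : B12.RunParams)

/-- ★★ **THE OPERAND ROWS AT ANY HISTORY FROM THE TERM ROWS** (dag-n11-w3's `operandRowsAt_of_termRows`, which is the case `s₀ := init s`, RE-RUN at an arbitrary history `s₀` of
length `k`): if `t₀` has the term rows `TermRowsAt θ p t₀ j` at the levels `1 ≤ j ≤ k`, then for EVERY branch `S` the operand `ω ↦ e^{A_k(s₀; t₀, E₀, U_k(𝐖(ω)))}` (background map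
`UbgOfRecord₁₃CoP … k s₀`) is measurable on the multiscale configuration space, and the operand is bounded above.  (2.23) at index `k` reads the levels `1 … k` only
(`sect2Operand_congr_of_agree_pos`), so the operand of `t₀` IS the operand of its truncation `graftAbove 0 0 (graftAbove k t₀ 0)`, which has dag-n11-d's ALL-level term rows; then
`measurable_sect2Operand_of_termRows` (with `measurable_UbgOfRecord₁₃CoP`) and `exists_bound_sect2Operand_of_termBounds`.  Proof text: dag-n11-w3's, with `init s ↦ s₀`.
[cite: Balaban1988Convergent, (2.18) p.257, (2.20)–(2.25) pp.258–259, (2.30) p.260, (2.40) p.261, (3.16)–(3.21) pp.268–269] -/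
theorem operandRows_at_history_of_termRows (k : ℕ) (s₀ : SeqOfRecord F θ.ν θ.τ9.M (gOfRecord₁₃ F N θ.toStage13Params p) p.K k)
    (t₀ : Sect2.TermValues (F.P p.K) (MatA N) (FluctV N) θ.τ9.M) (E₀ : ℝ) (hrows : ∀ j, 1 ≤ j → j ≤ k → TermRowsAt θ p t₀ j)
    (S : ℕ → Set (Site (F.P p.K) 0)) :
    Measurable (fun ω : MultiCfg (F.P p.K) (SU N) (FluctV N) =>
      sect2Operand F N (FluctV N) p.K (settingOfRecord₁₃ F N θ.toStage13Params p) (θ.rzAt p s₀) s₀ t₀ E₀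
          (UbgOfRecord₁₃CoP F N θ.toStage13Params p k s₀) (S, fun j => (ω j).2) (fun j => (ω j).1)) ∧
    ∃ CΦ : ℝ, ∀ a U, sect2Operand F N (FluctV N) p.K (settingOfRecord₁₃ F N θ.toStage13Params p) (θ.rzAt p s₀) s₀ t₀ E₀
          (UbgOfRecord₁₃CoP F N θ.toStage13Params p k s₀) a U ≤ CΦ := by
  -- the truncation of `t₀` to the levels `1 … k`
  set tr : Sect2.TermValues (F.P p.K) (MatA N) (FluctV N) θ.τ9.M := graftAbove 0 Sect2.TermValues.zero (graftAbove k t₀ Sect2.TermValues.zero) with htr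
  -- it agrees with `t₀` on `[1, k]` …
  have hagE : ∀ j, 1 ≤ j → j ≤ k → ∀ (X : (Sect2.domSys (F.P p.K) θ.τ9.M j).Dom) (z : Site (F.P p.K) j) (gc : ℝ) (φ : Sect2.CPair (F.P p.K) (MatA N)),
      tr.E j X z gc φ = t₀.E j X z gc φ := fun j h1 hj X z gc φ => by
    rw [htr, graftAbove_E_of_lt _ _ (Nat.lt_of_lt_of_le Nat.zero_lt_one h1), graftAbove_E_of_le _ _ hj]
  have hagR : ∀ j, 1 ≤ j → j ≤ k → ∀ (X : (Sect2.domSys (F.P p.K) θ.τ9.M j).Dom) (φ : Sect2.CPair (F.P p.K) (MatA N)), tr.R j X φ = t₀.R j X φ := fun j h1 hj X φ => by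
    rw [htr, graftAbove_R_of_lt _ _ (Nat.lt_of_lt_of_le Nat.zero_lt_one h1), graftAbove_R_of_le _ _ hj]
  have hagB : ∀ j, 1 ≤ j → j ≤ k → ∀ (X : (Sect2.domSys (F.P p.K) θ.τ9.M j).Dom) (φ : Sect2.CPair (F.P p.K) (MatA N)) (a : Tk.SFluct (F.P p.K) (FluctV N)),
      tr.B j X φ a = t₀.B j X φ a := fun j h1 hj X φ a => by
    rw [htr, graftAbove_B_of_lt _ _ (Nat.lt_of_lt_of_le Nat.zero_lt_one h1), graftAbove_B_of_le _ _ hj]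
  -- … and is ZERO off `[1, k]`
  have hzE : ∀ j, ¬ (1 ≤ j ∧ j ≤ k) → ∀ (X : (Sect2.domSys (F.P p.K) θ.τ9.M j).Dom) (z : Site (F.P p.K) j) (gc : ℝ) (φ : Sect2.CPair (F.P p.K) (MatA N)),
      tr.E j X z gc φ = 0 := fun j hj X z gc φ => by
    by_cases h0 : j = 0
    · subst h0; rw [htr, graftAbove_E_of_le _ _ le_rfl]; rfl
    · have hjk : k < j := by omega
      rw [htr, graftAbove_E_of_lt _ _ (Nat.pos_of_ne_zero h0), graftAbove_E_of_lt _ _ hjk]; rfl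
  have hzR : ∀ j, ¬ (1 ≤ j ∧ j ≤ k) → ∀ (X : (Sect2.domSys (F.P p.K) θ.τ9.M j).Dom) (φ : Sect2.CPair (F.P p.K) (MatA N)), tr.R j X φ = 0 := fun j hj X φ => by
    by_cases h0 : j = 0
    · subst h0; rw [htr, graftAbove_R_of_le _ _ le_rfl]; rfl
    · have hjk : k < j := by omega
      rw [htr, graftAbove_R_of_lt _ _ (Nat.pos_of_ne_zero h0), graftAbove_R_of_lt _ _ hjk]; rfl
  have hzB : ∀ j, ¬ (1 ≤ j ∧ j ≤ k) → ∀ (X : (Sect2.domSys (F.P p.K) θ.τ9.M j).Dom) (φ : Sect2.CPair (F.P p.K) (MatA N)) (a : Tk.SFluct (F.P p.K) (FluctV N)),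
      tr.B j X φ a = 0 := fun j hj X φ a => by
    by_cases h0 : j = 0
    · subst h0; rw [htr, graftAbove_B_of_le _ _ le_rfl]; rfl
    · have hjk : k < j := by omega
      rw [htr, graftAbove_B_of_lt _ _ (Nat.pos_of_ne_zero h0), graftAbove_B_of_lt _ _ hjk]; rfl
  -- hence the truncation has the rows at EVERY level
  have htrows : ∀ j, TermRowsAt θ p tr j := fun j => by
    by_cases hj : 1 ≤ j ∧ j ≤ k
    · exact termRowsAt_of_eq (hagE j hj.1 hj.2) (hagR j hj.1 hj.2) (hagB j hj.1 hj.2) (hrows j hj.1 hj.2) (hrows j hj.1 hj.2) (hrows j hj.1 hj.2)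
    · exact termRowsAt_of_eq (t₁ := Sect2.TermValues.zero) (t₂ := Sect2.TermValues.zero) (t₃ := Sect2.TermValues.zero)
        (fun X z gc φ => hzE j hj X z gc φ) (fun X φ => hzR j hj X φ) (fun X φ a => hzB j hj X φ a) (termRowsAt_zero j) (termRowsAt_zero j) (termRowsAt_zero j)
  -- the operand of `t₀` is the operand of the truncation
  rw [← sect2Operand_congr_of_agree_pos (settingOfRecord₁₃ F N θ.toStage13Params p) (θ.rzAt p s₀) s₀ hagE hagR hagB E₀
    (UbgOfRecord₁₃CoP F N θ.toStage13Params p k s₀)]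
  -- one bound per row family, uniform over the levels (zero above `k`)
  have hbE : ∃ CE : ℝ, ∀ (j : ℕ) (X : (Sect2.domSys (F.P p.K) θ.τ9.M j).Dom) (z : Site (F.P p.K) j) (g' : ℝ) (U : GaugeField (F.P p.K) 0 (SU N)),
      |(tr.E j X z g' (Sect2.ofBackgroundC (settingOfRecord₁₃ F N θ.toStage13Params p).ι U)).re| ≤ CE := by
    obtain ⟨C, hC⟩ := exists_uniform_bound
      (X := fun j => (Sect2.domSys (F.P p.K) θ.τ9.M j).Dom × Site (F.P p.K) j × ℝ × GaugeField (F.P p.K) 0 (SU N))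
      (f := fun j x => (tr.E j x.1 x.2.1 x.2.2.1 (Sect2.ofBackgroundC (settingOfRecord₁₃ F N θ.toStage13Params p).ι x.2.2.2)).re) k
      (fun j => by obtain ⟨C, hC⟩ := (htrows j).2.1; exact ⟨C, fun x => hC x.1 x.2.1 x.2.2.1 x.2.2.2⟩)
      (fun j hj x => by
        have h : ¬ (1 ≤ j ∧ j ≤ k) := fun h => absurd h.2 (not_le.mpr hj)
        simp only [hzE j h, Complex.zero_re])
    exact ⟨C, fun j X z g' U => hC j (X, z, g', U)⟩
  have hbR : ∃ CR : ℝ, ∀ (j : ℕ) (X : (Sect2.domSys (F.P p.K) θ.τ9.M j).Dom) (U : GaugeField (F.P p.K) 0 (SU N)),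
      |(tr.R j X (Sect2.ofBackgroundC (settingOfRecord₁₃ F N θ.toStage13Params p).ι U)).re| ≤ CR := by
    obtain ⟨C, hC⟩ := exists_uniform_bound
      (X := fun j => (Sect2.domSys (F.P p.K) θ.τ9.M j).Dom × GaugeField (F.P p.K) 0 (SU N))
      (f := fun j x => (tr.R j x.1 (Sect2.ofBackgroundC (settingOfRecord₁₃ F N θ.toStage13Params p).ι x.2)).re) k
      (fun j => by obtain ⟨C, hC⟩ := (htrows j).2.2.2.1; exact ⟨C, fun x => hC x.1 x.2⟩)
      (fun j hj x => by
        have h : ¬ (1 ≤ j ∧ j ≤ k) := fun h => absurd h.2 (not_le.mpr hj)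
        simp only [hzR j h, Complex.zero_re])
    exact ⟨C, fun j X U => hC j (X, U)⟩
  have hbB : ∃ CB : ℝ, ∀ (j : ℕ) (X : (Sect2.domSys (F.P p.K) θ.τ9.M j).Dom) (U : GaugeField (F.P p.K) 0 (SU N)) (a : Tk.SFluct (F.P p.K) (FluctV N)),
      |(tr.B j X (Sect2.ofBackgroundC (settingOfRecord₁₃ F N θ.toStage13Params p).ι U) a).re| ≤ CB := by
    obtain ⟨C, hC⟩ := exists_uniform_bound
      (X := fun j => (Sect2.domSys (F.P p.K) θ.τ9.M j).Dom × GaugeField (F.P p.K) 0 (SU N) × Tk.SFluct (F.P p.K) (FluctV N))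
      (f := fun j x => (tr.B j x.1 (Sect2.ofBackgroundC (settingOfRecord₁₃ F N θ.toStage13Params p).ι x.2.1) x.2.2).re) k
      (fun j => by obtain ⟨C, hC⟩ := (htrows j).2.2.2.2.2; exact ⟨C, fun x => hC x.1 x.2.1 x.2.2⟩)
      (fun j hj x => by
        have h : ¬ (1 ≤ j ∧ j ≤ k) := fun h => absurd h.2 (not_le.mpr hj)
        simp only [hzB j h, Complex.zero_re])
    exact ⟨C, fun j X U a => hC j (X, U, a)⟩
  exact ⟨measurable_sect2Operand_of_termRows p.K _ _ s₀ tr E₀ (measurable_UbgOfRecord₁₃CoP F N θ.toStage13Params p k s₀) S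
      (fun j X z g' => (htrows j).1 X z g') (fun j X => (htrows j).2.2.1 X) (fun j X => (htrows j).2.2.2.2.1 S X),
    exists_bound_sect2Operand_of_termBounds p.K _ _ s₀ tr E₀ _ hbE hbR hbB⟩

end AtHistory

/-! ## §2  The term rows of the bare graft `graftAboveB k t u` -/

section Graft

variable {θ : Stage13HParams F N} {p : B12.RunParams}

/-- ★ **THE TERM ROWS PASS THROUGH THE GRAFT `graftAboveB k t u`, LEVEL BY LEVEL** (the witness of `PresentChildObligations`' (O3′) clause is `graftAboveB k (t s′.init) (tnew s′)`): the
level-`j` rows of the graft follow from those of `t` at `j` (needed when `j ≤ k`: its `𝐄`, `𝐑`, and for `j < k` its `𝐁`) and of `u` at `j` (needed when `k ≤ j`: its `𝐁` from the level `k`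
on, its `𝐄`, `𝐑` above `k`) — dag-n11-w3's transfer `termRowsAt_of_eq` in the three cases `j < k`, `j = k`, `k < j` (the present case of their `termRowsAt_spliceTermsB`, for the bare
graft). [cite: Balaban1988Convergent, §3 p.279, (3.24)–(3.25) p.270, (2.40)–(2.41) p.261 (bookkeeping)] -/
theorem termRowsAt_graftAboveB (k : ℕ) (t u : Sect2.TermValues (F.P p.K) (MatA N) (FluctV N) θ.τ9.M) (j : ℕ)
    (hold : j ≤ k → TermRowsAt θ p t j) (hnew : k ≤ j → TermRowsAt θ p u j) : TermRowsAt θ p (graftAboveB k t u) j := by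
  by_cases hjk : j ≤ k
  · have ho := hold hjk
    by_cases hjk' : j < k
    · exact termRowsAt_of_eq (fun X z g' φ => graftAboveB_E_of_le _ _ hjk X z g' φ) (fun X φ => graftAboveB_R_of_le _ _ hjk X φ)
        (fun X φ a => graftAboveB_B_of_lt _ _ hjk' X φ a) ho ho ho
    · exact termRowsAt_of_eq (fun X z g' φ => graftAboveB_E_of_le _ _ hjk X z g' φ) (fun X φ => graftAboveB_R_of_le _ _ hjk X φ)
        (fun X φ a => graftAboveB_B_of_le _ _ (not_lt.mp hjk') X φ a) ho ho (hnew (not_lt.mp hjk'))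
  · have hjk' : k < j := not_le.mp hjk
    have hn := hnew hjk'.le
    exact termRowsAt_of_eq (fun X z g' φ => graftAboveB_E_of_lt _ _ hjk' X z g' φ) (fun X φ => graftAboveB_R_of_lt _ _ hjk' X φ)
      (fun X φ a => graftAboveB_B_of_le _ _ hjk'.le X φ a) hn hn hn

/-- The graft of `PresentChildObligations` has the rows at EVERY level `1 ≤ j ≤ k+1` when the old value has them at `1 … k` and the response at `k` and `k+1`.
[cite: Balaban1988Convergent, §3 p.279, (3.24)–(3.25) p.270 (bookkeeping)] -/
theorem termRowsAt_graftAboveB_all (k : ℕ) (t u : Sect2.TermValues (F.P p.K) (MatA N) (FluctV N) θ.τ9.M)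
    (hold : ∀ j, 1 ≤ j → j ≤ k → TermRowsAt θ p t j) (hnew : ∀ j, k ≤ j → j ≤ k + 1 → TermRowsAt θ p u j) :
    ∀ j, 1 ≤ j → j ≤ k + 1 → TermRowsAt θ p (graftAboveB k t u) j :=
  fun j h1 hj => termRowsAt_graftAboveB k t u j (fun hjk => hold j h1 hjk) (fun hkj => hnew j hkj hj)

end Graft

/-! ## §3  The old-branch (O3′) theorem `_of_provisos` with its two operand rows read from term rows -/

section Stage13

/-- ★★★★★★ **THE (O3′) DISJUNCTION ON THE OLD-BRANCH ROAD, OPERAND ROWS FROM TERM ROWS**: `…OldBranchInnerSumOfProvisos.slotsTOfRecord₁₃H_succ_O3_of_hasSect2FormAtZS_of_oldBranchInnerSum_of_provisos`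
with the old-operand row `hΦ₀m` READ FROM `TermRowsAt θ p (t s′.init) j` (`1 ≤ j ≤ k`) and the new-operand row `hΦm` READ FROM `TermRowsAt θ p t′ j` (`1 ≤ j ≤ k+1`) by §1 (at the
histories `init s′` and `s′`).  Displayed: `h : θ.Provisos₁₃CoPH F N`, `hform`, the four residual-measurability rows, the two term-row families, `Fᵢ₀` ∕ `hFm₀` ∕ `hin₀` ∕ `hinner₀`.
[cite: Balaban1988Convergent, Thm 1 p.262, Thm 2 p.263, §3 p.279, (3.1) p.264, (3.24)–(3.25) p.270, (2.18) p.257, (2.20)–(2.23) p.258] -/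
theorem slotsTOfRecord₁₃H_succ_O3_of_hasSect2FormAtZS_of_oldBranchInnerSum_of_provisos_of_termRows (θ : Stage13HParams F N) (h : θ.Provisos₁₃CoPH F N)
    (p : B12.RunParams) {k : ℕ} (hkK : k < p.K)
    {hdec : DecidableEq (PBond (F.P p.K) k)} {hdec' : DecidableEq (PBond (F.P p.K) (k + 1))} (hk : k + 1 ≤ (F.P p.K).m + (F.P p.K).K)
    (s' : SeqOfRecord F θ.ν θ.τ9.M (gOfRecord₁₃ F N θ.toStage13Params p) p.K (k + 1))
    {law : SeqOfRecord F θ.ν θ.τ9.M (gOfRecord₁₃ F N θ.toStage13Params p) p.K k → Sect2.TermValues (F.P p.K) (MatA N) (FluctV N) θ.τ9.M → Prop}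
    {t : SeqOfRecord F θ.ν θ.τ9.M (gOfRecord₁₃ F N θ.toStage13Params p) p.K k → Sect2.TermValues (F.P p.K) (MatA N) (FluctV N) θ.τ9.M}
    {Ek : SeqOfRecord F θ.ν θ.τ9.M (gOfRecord₁₃ F N θ.toStage13Params p) p.K k → ℝ}
    (hform : HasSect2FormAtZS F N (FluctV N) p.K (settingOfRecord₁₃ F N θ.toStage13Params p) k (θ.rzAt p) (WtOfRecord₁₃H F N θ p)
      (UbgOfRecord₁₃CoP F N θ.toStage13Params p k) law
      (slotsOfRecord F N θ.ν θ.τ9 (EOfRecord₁₃ F N θ.toStage13Params) (wOfRecord₉ F N θ.toStage9Params) θ.ppSel p (gOfRecord₁₃ F N θ.toStage13Params p) k) t Ek)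
    (t' : Sect2.TermValues (F.P p.K) (MatA N) (FluctV N) θ.τ9.M) (E' : ℝ)
    -- measurability of the residuals serving `init s′` and `s′` (dag-n11-e's `ResidualRowsAt` shapes) …
    (hζ0m : ∀ j Y, Measurable ((θ.zhAt p s'.init).ζ0 j Y)) (hqm : ∀ j Λ', Measurable ((θ.zhAt p s'.init).quad j Λ'))
    (hζm : ∀ j Y, Measurable ((θ.zhAt p s').ζ0 j Y)) (hqm' : ∀ j Λ', Measurable ((θ.zhAt p s').quad j Λ'))
    -- … and dag-n11-w3's TERM ROWS of the old witness value at the levels `1 … k` and of the proposed new one at the levels `1 … k+1`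
    (htrows₀ : ∀ j, 1 ≤ j → j ≤ k → TermRowsAt θ p (t s'.init) j) (htrows : ∀ j, 1 ≤ j → j ≤ k + 1 → TermRowsAt θ p t' j)
    (Fᵢ₀ : (ℕ → Set (Site (F.P p.K) 0)) → (↥(Set.toFinite (bondsIn k (s'.Ω (k + 1))ᶜ)).toFinset → SU N) ×
        ({c : PBond (F.P p.K) (k + 1) // c ∉ (Set.toFinite (bondsIn (k + 1) (s'.Ω (k + 1))ᶜ)).toFinset} → SU N) → ℝ)
    (hFm₀ : ∀ S₀ ∈ admSOfRecord F θ.ν θ.τ9.M (gOfRecord₁₃ F N θ.toStage13Params p) p.K k s'.init, Measurable (Fᵢ₀ S₀))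
    (hin₀ : ∀ S₀ ∈ admSOfRecord F θ.ν θ.τ9.M (gOfRecord₁₃ F N θ.toStage13Params p) p.K k s'.init, kernelTransport
        ((Measure.pi fun _ : ↥(Set.toFinite (bondsIn k (s'.Ω (k + 1))ᶜ)).toFinset => (HaarData.haar : Measure (SU N))).prod
          (Measure.pi fun _ : {b : PBond (F.P p.K) k // b ∉ (Set.toFinite (bondsIn k (s'.Ω (k + 1))ᶜ)).toFinset} => (HaarData.haar : Measure (SU N))))
        ((Measure.pi fun _ : ↥(Set.toFinite (bondsIn k (s'.Ω (k + 1))ᶜ)).toFinset => (HaarData.haar : Measure (SU N))).prod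
          (Measure.pi fun _ : {c : PBond (F.P p.K) (k + 1) // c ∉ (Set.toFinite (bondsIn (k + 1) (s'.Ω (k + 1))ᶜ)).toFinset} =>
            (HaarData.haar : Measure (SU N))))
        (fun q => (q.1, fun c : {c : PBond (F.P p.K) (k + 1) // c ∉ (Set.toFinite (bondsIn (k + 1) (s'.Ω (k + 1))ᶜ)).toFinset} =>
          (avOfRecord F N p.K k).avg
            ((MeasurableEquiv.piEquivPiSubtypeProd (fun _ : PBond (F.P p.K) k => SU N)
              (· ∈ (Set.toFinite (bondsIn k (s'.Ω (k + 1))ᶜ)).toFinset)).symm q) c))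
        ((fun U => wOfRecord₉ F N θ.toStage9Params p (gOfRecord₁₃ F N θ.toStage13Params p) k s' U ((avOfRecord F N p.K k).avg U) *
            (chiSeqOfRecord F N θ.ν θ.τ9.M (gOfRecord₁₃ F N θ.toStage13Params p) p.K k s'.init U *
              tkBranchOfRecord F N (FluctV N) θ.ν θ.τ9.M (gOfRecord₁₃ F N θ.toStage13Params p) p.K (WtOfRecord₁₃H F N θ p s'.init) s'.init S₀ k
                (fun ω => (sect2Operand F N (FluctV N) p.K (settingOfRecord₁₃ F N θ.toStage13Params p) (θ.rzAt p s'.init) s'.init (t s'.init) (Ek s'.init)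
            (UbgOfRecord₁₃CoP F N θ.toStage13Params p k s'.init)) (S₀, fun j => (ω j).2) (fun j => (ω j).1)) (baseCfg k U))) ∘
          ⇑(MeasurableEquiv.piEquivPiSubtypeProd (fun _ : PBond (F.P p.K) k => SU N)
            (· ∈ (Set.toFinite (bondsIn k (s'.Ω (k + 1))ᶜ)).toFinset)).symm)
      =ᵐ[((Measure.pi fun _ : ↥(Set.toFinite (bondsIn k (s'.Ω (k + 1))ᶜ)).toFinset => (HaarData.haar : Measure (SU N))).prod
          (Measure.pi fun _ : {c : PBond (F.P p.K) (k + 1) // c ∉ (Set.toFinite (bondsIn (k + 1) (s'.Ω (k + 1))ᶜ)).toFinset} =>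
            (HaarData.haar : Measure (SU N))))] Fᵢ₀ S₀)
    (hinner₀ : ∀ᵐ q ∂((Measure.pi fun _ : ↥(Set.toFinite (bondsIn (k + 1) (s'.Ω (k + 1))ᶜ)).toFinset => (HaarData.haar : Measure (SU N))).prod
          (Measure.pi fun _ : {c : PBond (F.P p.K) (k + 1) // c ∉ (Set.toFinite (bondsIn (k + 1) (s'.Ω (k + 1))ᶜ)).toFinset} =>
            (HaarData.haar : Measure (SU N)))),
      ∀ S₀ ∈ admSOfRecord F θ.ν θ.τ9.M (gOfRecord₁₃ F N θ.toStage13Params p) p.K k s'.init, ∀ y : ↥(Set.toFinite (bondsIn k (s'.Ω (k + 1))ᶜ)).toFinset → SU N,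
        avgRestrOfRecord F N p.K k (Set.toFinite (bondsIn k (s'.Ω (k + 1))ᶜ)).toFinset (Set.toFinite (bondsIn (k + 1) (s'.Ω (k + 1))ᶜ)).toFinset y = q.1 →
        Fᵢ₀ S₀ (y, q.2) =
          ∑ Y ∈ (Set.toFinite {Y : Set (Site (F.P p.K) 0) | Y ∈ SClassOfRecord F θ.ν (gOfRecord₁₃ F N θ.toStage13Params p) p.K (k + 1) ∧ Y ⊆ s'.Ω (k + 1) ∩ (s'.Λ (k + 1))ᶜ}).toFinset,
            zetaOp (genDataOfRecord F N (FluctV N) θ.ν θ.τ9.M (gOfRecord₁₃ F N θ.toStage13Params p) p.K (WtOfRecord₁₃H F N θ p s') s' (Function.update S₀ (k + 1) Y) k).ζ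
              (aOp k (genDataOfRecord F N (FluctV N) θ.ν θ.τ9.M (gOfRecord₁₃ F N θ.toStage13Params p) p.K (WtOfRecord₁₃H F N θ p s') s' (Function.update S₀ (k + 1) Y) k).sA
                (genDataOfRecord F N (FluctV N) θ.ν θ.τ9.M (gOfRecord₁₃ F N θ.toStage13Params p) p.K (WtOfRecord₁₃H F N θ p s') s' (Function.update S₀ (k + 1) Y) k).w
                (tkBranchOfRecord F N (FluctV N) θ.ν θ.τ9.M (gOfRecord₁₃ F N θ.toStage13Params p) p.K (WtOfRecord₁₃H F N θ p s') s'.init S₀ k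
                  (fun ω => (sect2Operand F N (FluctV N) p.K (settingOfRecord₁₃ F N θ.toStage13Params p) (θ.rzAt p s') s' t' E'
                  (UbgOfRecord₁₃CoP F N θ.toStage13Params p (k + 1) s')) (Function.update S₀ (k + 1) Y, fun j => (ω j).2) (fun j => (ω j).1))))
              (Function.update (baseCfg (k + 1) ((MeasurableEquiv.piEquivPiSubtypeProd (fun _ : PBond (F.P p.K) (k + 1) => SU N)
                (· ∈ (Set.toFinite (bondsIn (k + 1) (s'.Ω (k + 1))ᶜ)).toFinset)).symm q)) k
              (Function.updateFinset ((baseCfg (V := FluctV N) (k + 1) ((MeasurableEquiv.piEquivPiSubtypeProd (fun _ : PBond (F.P p.K) (k + 1) => SU N)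
                (· ∈ (Set.toFinite (bondsIn (k + 1) (s'.Ω (k + 1))ᶜ)).toFinset)).symm q)) k).1 (Set.toFinite (bondsIn k (s'.Ω (k + 1))ᶜ)).toFinset y,
                ((baseCfg (V := FluctV N) (k + 1) ((MeasurableEquiv.piEquivPiSubtypeProd (fun _ : PBond (F.P p.K) (k + 1) => SU N)
                (· ∈ (Set.toFinite (bondsIn (k + 1) (s'.Ω (k + 1))ᶜ)).toFinset)).symm q)) k).2))) :
    slotsTOfRecord F N θ.ν θ.τ9 (EOfRecord₁₃ F N θ.toStage13Params) (wOfRecord₉ F N θ.toStage9Params) θ.ppSel p (gOfRecord₁₃ F N θ.toStage13Params p) (k + 1) s' = 0 ∨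
      ∀ᵐ V' ∂fieldMeasure (F.P p.K) (k + 1) (SU N),
        chiSeqOfRecord F N θ.ν θ.τ9.M (gOfRecord₁₃ F N θ.toStage13Params p) p.K (k + 1) s' V' ≠ 0 →
          slotsTOfRecord F N θ.ν θ.τ9 (EOfRecord₁₃ F N θ.toStage13Params) (wOfRecord₉ F N θ.toStage9Params) θ.ppSel p (gOfRecord₁₃ F N θ.toStage13Params p) (k + 1) s' V' =
            sect2Slot F N (FluctV N) p.K (settingOfRecord₁₃ F N θ.toStage13Params p) (θ.rzAt p s') (WtOfRecord₁₃H F N θ p s') s' t' E'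
              (UbgOfRecord₁₃CoP F N θ.toStage13Params p (k + 1) s') V' :=
  slotsTOfRecord₁₃H_succ_O3_of_hasSect2FormAtZS_of_oldBranchInnerSum_of_provisos θ h p hkK (hdec := hdec) (hdec' := hdec') hk s' hform t' E' hζ0m hqm
    (fun S₀ _ => (operandRows_at_history_of_termRows θ p k s'.init (t s'.init) (Ek s'.init) htrows₀ S₀).1) hζm hqm'
    (fun S _ => (operandRows_at_history_of_termRows θ p (k + 1) s' t' E' htrows S).1) Fᵢ₀ hFm₀ hin₀ hinner₀

end Stage13

end Summit.QuantumFields.YangMills.Theorems.BalabanUVNodesN11OperandRowAtHistoryOfTermRows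

end
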